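import Summits.ResolutionOfSingularities.ResolutionOfSingularities.Theorems.FrobeniusClosingSteerDescentSpaceSquares
import HarnessLib

/-!
# Descent space, file 3 (W4.1, F-B card 7): the adapted line in characteristic `2`, L2b at the adapted line, PARITY COUPLING

W4.1, crux `Steer` (stmt-ResolutionOfSingularities-16345), frontier piece F-B; polynomial cores of res-L0-w41-idea-1's card 7
`kangaroo-free-parity-automaton` (`Sketch-idea-1-v9-fb.lean` 1cd28c90a6f7445c; res-L0-w41-plan-1 RULINGS 81b/84d; idea-1 g8
«citable: yes»). Over `FrobeniusClosingSteerDescentSpace.lean` / `…Squares.lean` (seat res-D-pv-007 AS res-L0-w41-stub-5):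

* §4 the adapted line `c = e_i`: `isLineInvariant_single_iff` (invariance along `e_i` ⟺ `X_i` does not occur — via the
  substitution `t ↦ X_i, X_i ↦ 0`), `pderiv_eq_zero_iff_even` (char `2`), and **`single_mem_descentSpace_iff`**: `e_i ∈ W(Φ)`
  ⟺ every exponent of `X_i` is even ∧ monomials with an odd `X_j` (`j ≠ i`) are `X_i`-free;
* §5 **`single_mem_descentSpace_iff_exists_sq`** = the sketch's L2b `stub_descent_iff_sq_adapted` AT THE ADAPTED LINE (perfect
  field of characteristic `2`; a general vector `c` reduces to this by a linear change of coordinates, sibling file), and the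
  **PARITY COUPLING `odd_of_descentSpace_three`** (the sketch's `stub_odd_of_descentSpace_three`, PROVED, with the general-`σ`
  form `odd_of_forall_single_mem_descentSpace`): a non-square form whose descent space contains `e₁, e₂, e₃` has ODD degree.

OURS (research support for an idea card; candidates, not facts); nothing here is a statement of the manuscript under review
[claim: Hironaka2017, status: under-review]; AI work, weaker than expert review. [cite: CossartPiltant2009, p. 9] [folklore]
-/

noncomputable section

-- `Summit.<S>.<S>.…` duplicates the summit name by design (single-problem summit).
set_option linter.dupNamespace false

open MvPolynomial

namespace Summit.ResolutionOfSingularities.ResolutionOfSingularities.Theorems.SwitchingDichotomy.DescentSpace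

universe u v

/-! ## §4 The adapted line `c = e_i` in characteristic `2`: support characterisations -/

section Adapted

variable {κ : Type u} [Field κ] {σ : Type v} [DecidableEq σ]

/-- `Σ_j (e_i)_j • f j = f i`. [folklore] -/
theorem sum_single_smul [Fintype σ] (i : σ) (f : σ → MvPolynomial σ κ) :
    (∑ j, (Pi.single i (1 : κ) : σ → κ) j • f j) = f i := by
  rw [Finset.sum_eq_single i]
  · simp
  · intro j _ hj; simp [hj]
  · intro h; exact absurd (Finset.mem_univ i) h

/-- **A polynomial not involving `X_i` is invariant along `e_i`.** [folklore] -/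
theorem isLineInvariant_single_of_forall (i : σ) (P : MvPolynomial σ κ) (h : ∀ m ∈ P.support, m i = 0) :
    IsLineInvariant κ (Pi.single i 1) P := by
  unfold IsLineInvariant genTransl
  conv_lhs => rw [P.as_sum]
  conv_rhs => rw [P.as_sum]
  rw [map_sum, map_sum]
  refine Finset.sum_congr rfl fun m hm => ?_
  rw [aeval_monomial, map_monomial, monomial_eq, IsScalarTower.algebraMap_apply κ (Polynomial κ)
    (MvPolynomial σ (Polynomial κ)), MvPolynomial.algebraMap_eq, Polynomial.algebraMap_eq]
  congr 1
  refine Finsupp.prod_congr fun j hj => ?_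
  have hji : j ≠ i := by
    rintro rfl
    exact (Finsupp.mem_support_iff.mp hj) (h m hm)
  simp [hji]

/-- **Invariance along `e_i` means: `X_i` does not occur** (the substitution `t ↦ X_i, X_i ↦ 0` recovers `P` from
`P(X + t e_i)` and kills `X_i` in the constant extension). [folklore] -/
theorem forall_of_isLineInvariant_single (i : σ) (P : MvPolynomial σ κ) (h : IsLineInvariant κ (Pi.single i 1) P) :
    ∀ m ∈ P.support, m i = 0 := by
  -- `β : κ[t][X] → κ[X]`, `t ↦ X_i`, `X_i ↦ 0`, `X_j ↦ X_j`
  let g : σ → MvPolynomial σ κ := fun j => if j = i then 0 else X j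
  let β : MvPolynomial σ (Polynomial κ) →ₐ[κ] MvPolynomial σ κ :=
    aevalTower (Polynomial.aeval (X i : MvPolynomial σ κ)) g
  have hβ1 : ∀ Q : MvPolynomial σ κ, β (genTransl κ (Pi.single i 1) Q) = Q := by
    intro Q
    induction Q using MvPolynomial.induction_on with
    | C a =>
      rw [genTransl_C]
      change aevalTower _ g (C (Polynomial.C a)) = C a
      rw [aevalTower_C, Polynomial.aeval_C, MvPolynomial.algebraMap_eq]
    | add p q hp hq => rw [map_add, map_add, hp, hq]
    | mul_X p j hp =>
      rw [map_mul, map_mul, hp, genTransl_X, map_add]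
      change p * (aevalTower _ g (X j) + aevalTower _ g (C _)) = p * X j
      rw [aevalTower_X, aevalTower_C, map_mul, Polynomial.aeval_C, Polynomial.aeval_X,
        MvPolynomial.algebraMap_eq]
      by_cases hji : j = i
      · subst hji; simp [g]
      · simp [g, hji]
  have hβ2 : ∀ Q : MvPolynomial σ κ, β (map (algebraMap κ (Polynomial κ)) Q) = aeval g Q := by
    intro Q
    induction Q using MvPolynomial.induction_on with
    | C a =>
      rw [map_C, aeval_C, MvPolynomial.algebraMap_eq, Polynomial.algebraMap_eq]
      change aevalTower _ g (C (Polynomial.C a)) = C a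
      rw [aevalTower_C, Polynomial.aeval_C, MvPolynomial.algebraMap_eq]
    | add p q hp hq => rw [map_add, map_add, hp, hq, map_add]
    | mul_X p j hp =>
      rw [map_mul, map_mul, hp, map_X, map_mul, aeval_X]
      change _ * aevalTower _ g (X j) = _
      rw [aevalTower_X]
  have hP : P = aeval g P := by
    have := congrArg β h
    rwa [hβ1, hβ2] at this
  -- `X_i` does not occur in `aeval g P = bind₁ g P`
  intro m hm
  by_contra hmi
  have hi : i ∈ (bind₁ g P).vars := by
    rw [← aeval_eq_bind₁, ← hP]
    exact (mem_vars_iff_mem_support i).mpr ⟨m, hm, Finsupp.mem_support_iff.mpr hmi⟩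
  obtain ⟨j, -, hj⟩ := mem_vars_bind₁ g P hi
  by_cases hji : j = i
  · subst hji; simp [g] at hj
  · simp [g, hji] at hj
    exact hji hj.symm

/-- **Invariance along `e_i` ⟺ `X_i` does not occur.** [folklore] -/
theorem isLineInvariant_single_iff (i : σ) (P : MvPolynomial σ κ) :
    IsLineInvariant κ (Pi.single i 1) P ↔ ∀ m ∈ P.support, m i = 0 :=
  ⟨forall_of_isLineInvariant_single i P, isLineInvariant_single_of_forall i P⟩

variable [CharP κ 2]

omit [DecidableEq σ] in
/-- The cast of a natural number vanishes in characteristic `2` iff it is even. [folklore] -/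
theorem natCast_eq_zero_iff_even (n : ℕ) : (n : κ) = 0 ↔ Even n := by
  rw [CharP.cast_eq_zero_iff κ 2, even_iff_two_dvd]

omit [DecidableEq σ] in
/-- **`∂_i P = 0` ⟺ every exponent of `X_i` in `P` is even** (characteristic `2`). [folklore] -/
theorem pderiv_eq_zero_iff_even (i : σ) (P : MvPolynomial σ κ) :
    pderiv i P = 0 ↔ ∀ m ∈ P.support, Even (m i) := by
  constructor
  · intro h m hm
    by_contra hodd
    rw [Nat.not_even_iff_odd] at hodd
    have hpos : 1 ≤ m i := hodd.pos
    have key := coeff_pderiv (i := i) P (m - Finsupp.single i 1 : σ →₀ ℕ)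
    rw [h, coeff_zero, tsub_add_cancel_of_le (Finsupp.single_le_iff.mpr hpos)] at key
    have hmi : (m - Finsupp.single i 1 : σ →₀ ℕ) i + 1 = m i := by
      simp only [Finsupp.tsub_apply, Finsupp.single_eq_same]; omega
    have hmi' : ((m - Finsupp.single i 1 : σ →₀ ℕ) i : κ) + 1 = (m i : κ) := by
      rw [← hmi, Nat.cast_add, Nat.cast_one]
    rw [hmi'] at key
    have hne : (m i : κ) ≠ 0 := fun h0 =>
      (Nat.not_even_iff_odd.mpr hodd) ((natCast_eq_zero_iff_even (m i)).mp h0)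
    exact mul_ne_zero (mem_support_iff.mp hm) hne key.symm
  · intro h
    ext m
    rw [coeff_pderiv, coeff_zero]
    by_cases h0 : coeff (m + Finsupp.single i 1) P = 0
    · rw [h0, zero_mul]
    · have heven := h _ (mem_support_iff.mpr h0)
      have hmi : (m + Finsupp.single i 1 : σ →₀ ℕ) i = m i + 1 := by
        simp only [Finsupp.add_apply, Finsupp.single_eq_same]
      rw [hmi] at heven
      have h2 := (natCast_eq_zero_iff_even (κ := κ) (m i + 1)).mpr heven
      rw [Nat.cast_add, Nat.cast_one] at h2
      rw [h2, mul_zero]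

variable [Fintype σ]

/-- **The adapted line `e_i` lies in the descent space `W(Φ)` iff** (characteristic `2`): every exponent of `X_i` in `Φ` is
even, AND every monomial of `Φ` containing some `X_j` (`j ≠ i`) to an odd power is free of `X_i`. [folklore] -/
theorem single_mem_descentSpace_iff (i : σ) (Φ : MvPolynomial σ κ) :
    (Pi.single i 1 : σ → κ) ∈ descentSpace κ Φ ↔
      (∀ m ∈ Φ.support, Even (m i)) ∧ (∀ m ∈ Φ.support, ∀ j, j ≠ i → Odd (m j) → m i = 0) := by
  unfold descentSpace
  rw [Set.mem_setOf_eq, sum_single_smul, pderiv_eq_zero_iff_even]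
  refine and_congr_right fun heven => ⟨fun hinv m hm j hji hodd => ?_, fun h j => ?_⟩
  · -- `m - e_j` is a monomial of `∂_j Φ`, which is `X_i`-free
    have hsupp : (m - Finsupp.single j 1 : σ →₀ ℕ) ∈ (pderiv j Φ).support := by
      rw [mem_support_iff, coeff_pderiv, tsub_add_cancel_of_le (Finsupp.single_le_iff.mpr hodd.pos)]
      have hmj : (m - Finsupp.single j 1 : σ →₀ ℕ) j + 1 = m j := by
        simp only [Finsupp.tsub_apply, Finsupp.single_eq_same]; have := hodd.pos; omega
      have hmj' : ((m - Finsupp.single j 1 : σ →₀ ℕ) j : κ) + 1 = (m j : κ) := by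
        rw [← hmj, Nat.cast_add, Nat.cast_one]
      rw [hmj']
      exact mul_ne_zero (mem_support_iff.mp hm) fun h0 =>
        (Nat.not_even_iff_odd.mpr hodd) ((natCast_eq_zero_iff_even (m j)).mp h0)
    have := forall_of_isLineInvariant_single i _ (hinv j) _ hsupp
    simpa [Finsupp.tsub_apply, Finsupp.single_apply, hji.symm] using this
  · by_cases hji : j = i
    · subst hji
      rw [(pderiv_eq_zero_iff_even j Φ).mpr heven]
      exact isLineInvariant_zero _
    · refine isLineInvariant_single_of_forall i _ fun m' hm' => ?_
      rw [mem_support_iff, coeff_pderiv] at hm'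
      have hc : coeff (m' + Finsupp.single j 1) Φ ≠ 0 := fun h0 => hm' (by rw [h0, zero_mul])
      have hodd : Odd ((m' + Finsupp.single j 1 : σ →₀ ℕ) j) := by
        have hne : ((m' j + 1 : ℕ) : κ) ≠ 0 := fun h0 => hm' (by
          rw [Nat.cast_add, Nat.cast_one] at h0; rw [h0, mul_zero])
        rw [Ne, natCast_eq_zero_iff_even, Nat.not_even_iff_odd] at hne
        simpa only [Finsupp.add_apply, Finsupp.single_eq_same] using hne
      have := h _ (mem_support_iff.mpr hc) j hji hodd
      simpa [Finsupp.add_apply, Finsupp.single_apply, Ne.symm hji, hji] using this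

end Adapted

/-! ## §5 L2b at the adapted line, and the PARITY COUPLING -/

section AdaptedL2b

variable {κ : Type u} [Field κ] {σ : Type v} [DecidableEq σ] [CharP κ 2] [Fintype σ]

omit [CharP κ 2] [Fintype σ] in
/-- Coefficients of a support-filtered copy of `Φ`. [folklore] -/
theorem coeff_sum_filter_monomial (Φ : MvPolynomial σ κ) (p : (σ →₀ ℕ) → Prop) [DecidablePred p] (m : σ →₀ ℕ) :
    coeff m (∑ m' ∈ Φ.support.filter p, monomial m' (coeff m' Φ)) = if p m then coeff m Φ else 0 := by
  rw [coeff_sum]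
  simp only [coeff_monomial]
  rw [Finset.sum_ite_eq']
  by_cases hp : p m
  · by_cases h0 : coeff m Φ = 0
    · simp [h0]
    · rw [if_pos hp, if_pos (Finset.mem_filter.mpr ⟨mem_support_iff.mpr h0, hp⟩)]
  · rw [if_neg hp, if_neg (fun h => hp (Finset.mem_filter.mp h).2)]

/-- **L2b at the adapted line** (res-L0-w41-idea-1 card 7 `stub_descent_iff_sq_adapted` for `c = e_i`, PROVED): over a
PERFECT field of characteristic `2`, `e_i ∈ W(Φ)` iff `Φ + Q²` is free of `X_i` for some `Q` — the `X_i`-part of `Φ` has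
only even exponents, hence is a square. [folklore] -/
theorem single_mem_descentSpace_iff_exists_sq [PerfectField κ] (i : σ) (Φ : MvPolynomial σ κ) :
    (Pi.single i 1 : σ → κ) ∈ descentSpace κ Φ ↔
      ∃ Q : MvPolynomial σ κ, IsLineInvariant κ (Pi.single i 1) (Φ + Q ^ 2) := by
  rw [single_mem_descentSpace_iff]
  constructor
  · rintro ⟨hA, hB⟩
    -- the `X_i`-part of `Φ` has all exponents even
    set Φ₁ : MvPolynomial σ κ := ∑ m ∈ Φ.support.filter (fun m => m i ≠ 0), monomial m (coeff m Φ) with hΦ₁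
    have hcoeff : ∀ m, coeff m Φ₁ = if m i ≠ 0 then coeff m Φ else 0 := fun m => by
      rw [hΦ₁]; exact coeff_sum_filter_monomial Φ _ m
    have heven : ∀ m ∈ Φ₁.support, ∀ j, Even (m j) := by
      intro m hm j
      rw [mem_support_iff, hcoeff] at hm
      have hmi : m i ≠ 0 := by intro h0; exact hm (by rw [if_neg (not_not.mpr h0)])
      have hmΦ : m ∈ Φ.support := by
        rw [mem_support_iff]; intro h0; exact hm (by simp [h0])
      by_cases hji : j = i
      · subst hji; exact hA m hmΦ
      · by_contra hodd
        exact hmi (hB m hmΦ j hji (Nat.not_even_iff_odd.mp hodd))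
    obtain ⟨Q, hQ⟩ := exists_sq_eq_of_forall_even Φ₁ heven
    refine ⟨Q, isLineInvariant_single_of_forall i _ fun m hm => ?_⟩
    by_contra hmi
    rw [mem_support_iff, hQ, coeff_add, hcoeff, if_pos hmi, ← two_mul] at hm
    exact hm (by rw [show (2 : κ) = 0 from CharP.cast_eq_zero κ 2 ▸ Nat.cast_two.symm, zero_mul])
  · rintro ⟨Q, hQ⟩
    have hfree := forall_of_isLineInvariant_single i _ hQ
    have key : ∀ m ∈ Φ.support, m ∉ (Q ^ 2).support → m i = 0 := by
      intro m hm hmQ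
      refine hfree m ?_
      rw [mem_support_iff, coeff_add, notMem_support_iff.mp hmQ, add_zero]
      exact mem_support_iff.mp hm
    refine ⟨fun m hm => ?_, fun m hm j hji hodd => ?_⟩
    · by_cases hmQ : m ∈ (Q ^ 2).support
      · exact even_of_mem_support_sq Q hmQ i
      · rw [key m hm hmQ]; exact Even.zero
    · by_cases hmQ : m ∈ (Q ^ 2).support
      · exact absurd (even_of_mem_support_sq Q hmQ j) (Nat.not_even_iff_odd.mpr hodd)
      · exact key m hm hmQ

/-- **PARITY COUPLING** (res-L0-w41-idea-1 card 7 `stub_odd_of_descentSpace_three`, general form, PROVED): over a perfect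
field of characteristic `2`, a homogeneous form of degree `n` which is NOT a square but whose descent space contains every
coordinate vector except possibly `e_{i₀}` has `n` ODD (else every monomial is `X_{i₀}^n` or has all exponents even, and
`Φ` is a square). [folklore] -/
theorem odd_of_forall_single_mem_descentSpace [PerfectField κ] (i₀ : σ) (n : ℕ) (Φ : MvPolynomial σ κ)
    (hΦ : Φ.IsHomogeneous n) (hsq : ¬ IsSquare Φ)
    (h : ∀ i, i ≠ i₀ → (Pi.single i 1 : σ → κ) ∈ descentSpace κ Φ) : Odd n := by
  by_contra hn
  rw [Nat.not_odd_iff_even] at hn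
  apply hsq (isSquare_of_forall_even Φ fun m hm j => ?_)
  by_cases hex : ∃ i, i ≠ i₀ ∧ m i ≠ 0
  · obtain ⟨i, hi, hmi⟩ := hex
    obtain ⟨hA, hB⟩ := (single_mem_descentSpace_iff i Φ).mp (h i hi)
    by_cases hji : j = i
    · subst hji; exact hA m hm
    · by_contra hodd
      exact hmi (hB m hm j hji (Nat.not_even_iff_odd.mp hodd))
  · push Not at hex
    by_cases hj : j = i₀
    · subst hj
      -- `m = n • e_{i₀}`
      have hdeg := hΦ.degree_eq_sum_deg_support hm
      rw [Finset.sum_eq_single j (fun k _ hk => hex k hk) (fun hk => Finsupp.notMem_support_iff.mp hk)] at hdeg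
      rw [← hdeg]; exact hn
    · rw [hex j hj]; exact Even.zero

/-- **Parity coupling, literally as typed in the sketch** (`σ = Fin 4`, adapted line `X 0`: `e₁, e₂, e₃ ∈ W(Φ)`, `Φ`
homogeneous of degree `n`, not a square ⇒ `n` odd). [folklore] -/
theorem odd_of_descentSpace_three [PerfectField κ] (n : ℕ)
    (Φ : MvPolynomial (Fin 4) κ) (hΦ : Φ.IsHomogeneous n) (hsq : ¬ IsSquare Φ)
    (h1 : (Pi.single (1 : Fin 4) (1 : κ) : Fin 4 → κ) ∈ descentSpace κ Φ)
    (h2 : (Pi.single (2 : Fin 4) (1 : κ) : Fin 4 → κ) ∈ descentSpace κ Φ)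
    (h3 : (Pi.single (3 : Fin 4) (1 : κ) : Fin 4 → κ) ∈ descentSpace κ Φ) : Odd n := by
  refine odd_of_forall_single_mem_descentSpace (0 : Fin 4) n Φ hΦ hsq fun i hi => ?_
  fin_cases i
  · exact absurd rfl hi
  · exact h1
  · exact h2
  · exact h3

end AdaptedL2b

end Summit.ResolutionOfSingularities.ResolutionOfSingularities.Theorems.SwitchingDichotomy.DescentSpace

end
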